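import Summits.AtomisticToContinuum.Crystallization.Theses.PhononSlackCertificates
import Summits.AtomisticToContinuum.Crystallization.Theses.HullMinimality
import Summits.AtomisticToContinuum.Crystallization.Theorems.PhononSlackCertificatesPeriodicGivenLayeredExtraction
import Summits.AtomisticToContinuum.Crystallization.Theorems.PhononSlackCertificatesPeriodicGivenLayeredRecurrence
import Summits.AtomisticToContinuum.Crystallization.Theorems.PhononSlackCertificatesPeriodicGivenLayeredWindowBounds
import Summits.AtomisticToContinuum.Crystallization.Theorems.PhononSlackCertificatesPeriodicGivenLayeredRegistry
import Summits.AtomisticToContinuum.Crystallization.Theorems.PhononSlackCertificatesPeriodicGivenLayeredConvexity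
import Summits.AtomisticToContinuum.Crystallization.Theorems.PhononSlackCertificatesPeriodicGivenLayeredLayerCake
import Summits.AtomisticToContinuum.Crystallization.Theorems.PhononSlackCertificatesPeriodicGivenLayeredClosing3
import Summits.AtomisticToContinuum.Crystallization.Theorems.PhononSlackCertificatesPeriodicGivenLayeredClosing6
import Literature.MathematicalPhysics.StatisticalMechanics.BarlowStackingEnergy
import Literature.MathematicalPhysics.StatisticalMechanics.CrystallizationSymmetries

/-!
# `PeriodicGivenLayered` (stmt-AtomisticToContinuum-11779) — line `Sketch` (recurrent-limit density closing)

Proof of the crux along the line `Sketch` (lead: prover-line-stmt-AtomisticToContinuum-11779-0). The crux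
`PhononSlackCertificates.PeriodicGivenLayered` (= `HullMinimality.PeriodicGivenLayered`): for every sequence
`x` of Lennard-Jones ground states, layered windows at every scale (one in-layer spacing `a ∈ [47/50, 1]`,
free Hägg word, free interlayer spacings in `[39a/50, 17a/20]`, a rigid motion per window) imply periodic
windows at every scale (ONE periodic `P`, translations only).

Composition (`PeriodicGivenLayered_of`; every stub is a landed theorem of this namespace):

1. `stub_extraction` — compactness of `O(3) × {±1}^ℤ × [−17a/20, 0] × [39a/50, 17a/20]^ℤ` and a finite
   subcover argument over the "frequently in `N`" windows: ONE exactly layered set `A(S(a, s, z))` lies in the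
   hull of `x` (is two-way `ε`-matched on `B(0,R)` by translates of `x N`, frequently in `N`, for all `R, ε`).
2. `stub_recurrence` — symbolic dynamics: the shift-orbit closure of `(s, Δz)` in the compact product space
   has a minimal subset, whose points are uniformly recurrent; the hull of `x` is closed under translations and
   local limits, so it contains a layered set with UNIFORMLY RECURRENT data `(s', z')` (same `a`, same `A`).
3. `stub_windowBounds` — (U) finite-`N` cut-and-paste: for a set `S` in the hull of a ground-state sequence and
   a finite `W ⊆ S`, `Σ_{p ∈ W} e_p(S) ≤ 2 E(#W) + C · ∂(W)` (`e_p` the site energy in the infinite set, `E(M)`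
   the `M`-particle ground-state energy, `∂(W) = Σ_{p∈W} (1 + dist(p, S ∖ W))⁻³`); (L) for ANY `δ`-separated
   `S`: `Σ_{p ∈ W} e_p(S) ≥ 2 E(#W) − C · ∂(W)` (trivial: `E(#W) ≤` energy of `W`).
4. `stub_registry` — the only Lennard-Jones-specific input on the word side (card A): the registry coupling
   `D_a(H) = barlowCoupling lennardJones a H 1` is `≤ 0` and non-decreasing on `[39a/25, ∞)` and has a
   positive corner gap `D_a(117a/50) − D_a(17a/10) ≥ c₀ > 0` (certified numerics + one-crossing transport).
5. `stub_convexity` — uniform midpoint convexity of the alternating block energy in the increments on the box,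
   uniformly in the block length (certified numerics: diagonal dominance of the interlayer Hessian).
6. `stub_layerCake` — bookkeeping of exactly layered sets: `1/2`-separation, decay `|Φ(H)| ≤ C/H⁴` of the
   layer sums, the site energy of a point of layer `m` as `Φ₀ + Σ'_{m' ≠ m} Φ(z m' − z m, L m' − L m)`, and
   the prisms `W(m₁, n, K)` (`n` layers × `K × K` sites): `#W = n K²`, `Σ_W e_p = K² Σ_m ε_m`,
   `∂(W) ≤ C (nK + K²)`.
7. `stub_closing` — density closing: with 3–6 as hypotheses, a uniformly recurrent layered set in the hull of
   a ground-state sequence has NO stacking fault (`s'(m+1) = −s'(m)`) and CONSTANT increments. (A fault, resp.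
   an increment oscillation, recurs with bounded gaps; on prisms the per-fault price `c₀` (4 + the landed
   majorisation lemma), resp. `κ η²` (5, Jensen against the averaged increments), is linear in the volume,
   while (U) − (L) at EQUAL cardinality `n K²` is `O(nK + K²)` — the ground-state energies cancel.)
8. `pgl_readoff` (proved here) — a fault-free, equally spaced layered set is `A(barlowStacking a h s + z₀ e₃)`, the
   point set of a `PeriodicConfiguration 3` (`barlowPeriodicConfiguration`, period 2); being in the hull is
   literally the crux's conclusion.

No `CrysEnergyLimit`, no `e*`, no surgery, no relaxation rates are used. Helpers already landed for this line:
`PhononSlackCertificatesPeriodicGivenLayeredMajorisation` (alternating majorisation),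
`PhononSlackCertificatesPeriodicGivenLayeredOneCrossing` (one-crossing transport).
-/

noncomputable section

namespace Summit.AtomisticToContinuum.Crystallization.Theorems.LayeredHull

open scoped BigOperators
open Filter Literature.MathematicalPhysics.StatisticalMechanics

open Summit.AtomisticToContinuum.Crystallization.Theorems.ChargedEnergyGapNegative (E3)

/-! Stubs 1–6 (`stub_extraction`, `stub_recurrence`, `stub_windowBounds`, `stub_registry`, `stub_convexity`,
`stub_layerCake`) are LANDED (imported above): p107902, p104390, p104630, p106367, p107291, p110418; the two halves of
stub 7 are `clo_partA` (Closing3) and `clo_partB` (Closing6). -/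

/-! ## Stub 7 — density closing: recurrent layered sets in the hull are fault-free and equally spaced -/

/-- **Stub 7 (closing).** Let `x` be a sequence of Lennard-Jones ground states and `A(S(a,s,z))` a layered set
in the hull of `x` with uniformly recurrent data `(s, Δz)`. Assume the window bounds (U), (L) of stub 3, the
registry facts of stub 4, the increment convexity of stub 5 and the layer-cake facts of stub 6. Then `s` has no
stacking fault (`s (m+1) = − s m` for all `m`) and the increments are constant. Mechanism: a fault at `m₀`
recurs in every window of `G` layers; on the prism `W(m₁,n,K)` compare `S` with the restacked set (alternating
word, same heights): by the layer cake and alternating majorisation with the registry facts,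
`Σ_W e_p(S) − Σ_{W'} e_p(S') ≥ c₀ K² (n/(G+2) − 1)`, while (U) for `S` minus (L) for `S'` at the same
cardinality `nK²` is `≤ C(nK + K²)` — contradiction for `n, K` large; likewise an increment oscillation
`|Δ_{m₀} − Δ_{m₀+1}| = 2η₀ > 0` recurs, and (U) on the prisms at `m₁` and `m₁ + 1` of `S` against (L) on the
prism of the stack with averaged increments gives, by stub 5, `κ η₀² K² (n/(G+3) − 1) ≤ C(nK + K²) + C' K²`.
[folklore] -/
theorem stub_closing (x : (N : ℕ) → (Fin N → E3)) (hx : ∀ N, IsGroundState lennardJones (x N))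
    (a : ℝ) (ha : 47 / 50 ≤ a) (ha1 : a ≤ 1) (A : E3 →ₗᵢ[ℝ] E3) (s : ℤ → ℤ) (z : ℤ → ℝ)
    (hs : IsHaggSeq s) (hz : ∀ m : ℤ, 39 / 50 * a ≤ z (m + 1) - z m ∧ z (m + 1) - z m ≤ 17 / 20 * a)
    (hrec : ∀ (n : ℕ) (η : ℝ), 0 < η → ∀ m₀ : ℤ, ∃ G : ℕ, ∀ m : ℤ, ∃ g : ℤ, 0 ≤ g ∧ g ≤ G ∧
      ∀ k : ℕ, k < n → s (m + g + k) = s (m₀ + k) ∧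
        |(z (m + g + k + 1) - z (m + g + k)) - (z (m₀ + k + 1) - z (m₀ + k))| ≤ η)
    (hH : let S : Set E3 := {p | ∃ m i j : ℤ, p = A (((i : ℝ) • triangularVec₁ a) +
        ((j : ℝ) • triangularVec₂ a) + ((haggLabel s m : ℝ) • barlowOffset a) + (z m • layerNormal 1))};
      ∀ R ε : ℝ, 0 < ε → ∃ᶠ N in atTop, ∃ t : E3,
        (∀ p ∈ S, ‖p‖ ≤ R → ∃ i : Fin N, dist (x N i + t) p ≤ ε) ∧
        (∀ i : Fin N, ‖x N i + t‖ ≤ R → ∃ p ∈ S, dist (x N i + t) p ≤ ε))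
    (hU : ∃ C : ℝ, ∀ x : (N : ℕ) → (Fin N → E3), (∀ N, IsGroundState lennardJones (x N)) →
      ∀ S : Set E3, (∀ R ε : ℝ, 0 < ε → ∃ᶠ N in atTop, ∃ t : E3,
        (∀ p ∈ S, ‖p‖ ≤ R → ∃ i : Fin N, dist (x N i + t) p ≤ ε) ∧
        (∀ i : Fin N, ‖x N i + t‖ ≤ R → ∃ p ∈ S, dist (x N i + t) p ≤ ε)) →
      ∀ W : Finset E3, (↑W : Set E3) ⊆ S →
        ∑ p ∈ W, (∑' q : {q : E3 // q ∈ S ∧ q ≠ p}, lennardJones (dist p (q : E3))) ≤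
          2 * groundStateEnergy lennardJones 3 W.card +
            C * ∑ p ∈ W, (1 + Metric.infDist p (S \ (↑W : Set E3)))⁻¹ ^ 3)
    (hL : ∀ δ : ℝ, 0 < δ → ∃ C : ℝ, ∀ S : Set E3, (∀ p ∈ S, ∀ q ∈ S, p ≠ q → δ ≤ dist p q) →
      ∀ W : Finset E3, (↑W : Set E3) ⊆ S →
        2 * groundStateEnergy lennardJones 3 W.card -
            C * ∑ p ∈ W, (1 + Metric.infDist p (S \ (↑W : Set E3)))⁻¹ ^ 3 ≤
          ∑ p ∈ W, (∑' q : {q : E3 // q ∈ S ∧ q ≠ p}, lennardJones (dist p (q : E3))))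
    (hreg : ∃ c₀ : ℝ, 0 < c₀ ∧ ∀ a : ℝ, 47 / 50 ≤ a → a ≤ 1 →
      (∀ H H' : ℝ, 39 / 25 * a ≤ H → H ≤ H' →
        barlowCoupling lennardJones a H' 1 ≤ 0 ∧
          barlowCoupling lennardJones a H 1 ≤ barlowCoupling lennardJones a H' 1) ∧
      c₀ ≤ barlowCoupling lennardJones a (117 / 50 * a) 1 - barlowCoupling lennardJones a (17 / 10 * a) 1)
    (hconv : ∃ κ : ℝ, 0 < κ ∧ ∀ a : ℝ, 47 / 50 ≤ a → a ≤ 1 → ∀ (n : ℕ) (Δ Δ' : ℕ → ℝ),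
      (∀ i, i < n → 39 / 50 * a ≤ Δ i ∧ Δ i ≤ 17 / 20 * a) →
      (∀ i, i < n → 39 / 50 * a ≤ Δ' i ∧ Δ' i ≤ 17 / 20 * a) →
      κ * ∑ i ∈ Finset.range n, (Δ i - Δ' i) ^ 2 ≤
        (∑ i ∈ Finset.range n, ∑ j ∈ Finset.Ioc i n, layerInteraction lennardJones a
            (∑ l ∈ Finset.Ico i j, Δ l) (if Even (j - i) then 0 else 1) 1) +
        (∑ i ∈ Finset.range n, ∑ j ∈ Finset.Ioc i n, layerInteraction lennardJones a
            (∑ l ∈ Finset.Ico i j, Δ' l) (if Even (j - i) then 0 else 1) 1) -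
        2 * (∑ i ∈ Finset.range n, ∑ j ∈ Finset.Ioc i n, layerInteraction lennardJones a
            (∑ l ∈ Finset.Ico i j, (Δ l + Δ' l) / 2) (if Even (j - i) then 0 else 1) 1))
    (hcake : ∃ C : ℝ, ∀ a : ℝ, 47 / 50 ≤ a → a ≤ 1 →
      (∀ (H : ℝ) (δ : ℤ), 7 / 10 ≤ |H| → |layerInteraction lennardJones a H δ 1| ≤ C / H ^ 4) ∧
      ∀ (A : E3 →ₗᵢ[ℝ] E3) (s : ℤ → ℤ) (z : ℤ → ℝ), IsHaggSeq s →
        (∀ m : ℤ, 39 / 50 * a ≤ z (m + 1) - z m ∧ z (m + 1) - z m ≤ 17 / 20 * a) →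
        let S : Set E3 := {p | ∃ m i j : ℤ, p = A (((i : ℝ) • triangularVec₁ a) +
          ((j : ℝ) • triangularVec₂ a) + ((haggLabel s m : ℝ) • barlowOffset a) + (z m • layerNormal 1))};
        (∀ p ∈ S, ∀ q ∈ S, p ≠ q → 1 / 2 ≤ dist p q) ∧
        (∀ m : ℤ, Summable fun m' : ℤ => if m' = m then (0 : ℝ) else
          layerInteraction lennardJones a (z m' - z m) (haggLabel s m' - haggLabel s m) 1) ∧
        (∀ m i j : ℤ,
          (∑' q : {q : E3 // q ∈ S ∧ q ≠ A (((i : ℝ) • triangularVec₁ a) + ((j : ℝ) • triangularVec₂ a) +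
              ((haggLabel s m : ℝ) • barlowOffset a) + (z m • layerNormal 1))},
            lennardJones (dist (A (((i : ℝ) • triangularVec₁ a) + ((j : ℝ) • triangularVec₂ a) +
              ((haggLabel s m : ℝ) • barlowOffset a) + (z m • layerNormal 1))) (q : E3))) =
          inLayerInteraction lennardJones a + ∑' m' : ℤ, if m' = m then (0 : ℝ) else
            layerInteraction lennardJones a (z m' - z m) (haggLabel s m' - haggLabel s m) 1) ∧
        (∀ (m₁ : ℤ) (n K : ℕ),
          let W : Finset E3 := ((Finset.Ico m₁ (m₁ + n)) ×ˢ ((Finset.range K) ×ˢ (Finset.range K))).image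
            fun t : ℤ × (ℕ × ℕ) => A (((((t.2.1 : ℤ) - haggLabel s t.1 / 3 : ℤ) : ℝ) • triangularVec₁ a) +
              ((((t.2.2 : ℤ) - haggLabel s t.1 / 3 : ℤ) : ℝ) • triangularVec₂ a) +
              ((haggLabel s t.1 : ℝ) • barlowOffset a) + (z t.1 • layerNormal 1));
          (↑W : Set E3) ⊆ S ∧ W.card = n * K ^ 2 ∧
          (∑ p ∈ W, (∑' q : {q : E3 // q ∈ S ∧ q ≠ p}, lennardJones (dist p (q : E3)))) =
            (K : ℝ) ^ 2 * ∑ m ∈ Finset.Ico m₁ (m₁ + n), (inLayerInteraction lennardJones a +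
              ∑' m' : ℤ, if m' = m then (0 : ℝ) else
                layerInteraction lennardJones a (z m' - z m) (haggLabel s m' - haggLabel s m) 1) ∧
          (∑ p ∈ W, (1 + Metric.infDist p (S \ (↑W : Set E3)))⁻¹ ^ 3) ≤ C * (n * K + K ^ 2))) :
    (∀ m : ℤ, s (m + 1) = -s m) ∧ (∀ m : ℤ, z (m + 2) - z (m + 1) = z (m + 1) - z m) := by
  have hA : ∀ m : ℤ, s (m + 1) = -s m :=
    clo_partA x hx a ha ha1 A s z hs hz hrec hH hU hL hreg hcake
  exact ⟨hA, clo_partB x hx a ha ha1 A s z hs hz hrec hH hU hL hreg hconv hcake hA⟩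

/-! ## Read-off: a fault-free equally spaced layered set is a periodic configuration -/

/-- `layerNormal h = h • layerNormal 1`. [folklore] -/
theorem pgl_layerNormal_eq_smul (h : ℝ) : layerNormal h = h • layerNormal 1 := by
  ext i
  fin_cases i <;> simp [layerNormal]

/-- **Read-off.** If the Hägg word has no fault (`s (m+1) = −s m`, hence period `2`) and the heights are in
arithmetic progression (`z m = z 0 + m h`, `h > 0`), the layered set `A(S(a,s,z))` is the point set of a
periodic configuration: the isometric image under `A` of the translate by `z 0 · e₃` of
`barlowPeriodicConfiguration s` (period `2`, layer spacing `h`). [folklore] -/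
theorem pgl_readoff (a : ℝ) (ha : 47 / 50 ≤ a) (A : E3 →ₗᵢ[ℝ] E3) (s : ℤ → ℤ) (z : ℤ → ℝ)
    (hz : ∀ m : ℤ, 39 / 50 * a ≤ z (m + 1) - z m ∧ z (m + 1) - z m ≤ 17 / 20 * a)
    (h1 : ∀ m : ℤ, s (m + 1) = -s m) (h2 : ∀ m : ℤ, z (m + 2) - z (m + 1) = z (m + 1) - z m) :
    ∃ P : PeriodicConfiguration 3, P.points = {p | ∃ m i j : ℤ, p = A (((i : ℝ) • triangularVec₁ a) +
        ((j : ℝ) • triangularVec₂ a) + ((haggLabel s m : ℝ) • barlowOffset a) + (z m • layerNormal 1))} := by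
  -- the common increment `h = z 1 - z 0 > 0` and the arithmetic progression of heights
  set h : ℝ := z 1 - z 0 with hh_def
  have ha0 : a ≠ 0 := by intro h0; rw [h0] at ha; norm_num at ha
  have hh0 : h ≠ 0 := by
    have := (hz 0).1
    simp only [zero_add] at this
    intro h0; rw [hh_def] at h0; nlinarith
  have hstep : ∀ m : ℤ, z (m + 1) - z m = h := by
    have hup : ∀ n : ℕ, z ((n : ℤ) + 1) - z n = h := by
      intro n
      induction n with
      | zero => simp [hh_def]
      | succ n ih =>
        have := h2 (n : ℤ)
        push_cast at this ih ⊢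
        have e : (n : ℤ) + 1 + 1 = (n : ℤ) + 2 := by ring
        rw [e]
        linarith
    have hdown : ∀ n : ℕ, z (-(n : ℤ) + 1) - z (-(n : ℤ)) = h := by
      intro n
      induction n with
      | zero => simp [hh_def]
      | succ n ih =>
        have := h2 (-((n : ℤ) + 1))
        push_cast at this ih ⊢
        have e1 : -((n : ℤ) + 1) + 2 = -(n : ℤ) + 1 := by ring
        have e2 : -((n : ℤ) + 1) + 1 = -(n : ℤ) := by ring
        rw [e1, e2] at this
        rw [e2]
        linarith
    intro m
    rcases le_or_gt 0 m with hm | hm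
    · obtain ⟨n, rfl⟩ := Int.eq_ofNat_of_zero_le hm
      exact hup n
    · obtain ⟨n, hn⟩ := Int.exists_eq_neg_ofNat (le_of_lt hm)
      rw [hn]
      exact hdown n
  have harith : ∀ m : ℤ, z m = z 0 + m * h := by
    have hup : ∀ n : ℕ, z n = z 0 + n * h := by
      intro n
      induction n with
      | zero => simp
      | succ n ih =>
        have := hstep n
        push_cast at this ⊢
        linarith
    have hdown : ∀ n : ℕ, z (-(n : ℤ)) = z 0 + (-(n : ℤ)) * h := by
      intro n
      induction n with
      | zero => simp
      | succ n ih =>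
        have := hstep (-((n : ℤ) + 1))
        have e2 : -((n : ℤ) + 1) + 1 = -(n : ℤ) := by ring
        rw [e2] at this
        push_cast at this ih ⊢
        linarith
    intro m
    rcases le_or_gt 0 m with hm | hm
    · obtain ⟨n, rfl⟩ := Int.eq_ofNat_of_zero_le hm
      exact_mod_cast hup n
    · obtain ⟨n, hn⟩ := Int.exists_eq_neg_ofNat (le_of_lt hm)
      rw [hn]
      exact_mod_cast hdown n
  -- `s` has period `2`
  have hs2 : ∀ i : ℤ, s (i + 2) = s i := fun i => by
    rw [show i + 2 = i + 1 + 1 by ring, h1, h1, neg_neg]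
  -- the periodic configuration
  have key : ∀ m i j : ℤ, ((i : ℝ) • triangularVec₁ a) + ((j : ℝ) • triangularVec₂ a) +
      ((haggLabel s m : ℝ) • barlowOffset a) + (z m • layerNormal 1) =
      barlowPos a h s m i j + z 0 • layerNormal 1 := by
    intro m i j
    rw [barlowPos, harith m, pgl_layerNormal_eq_smul h, smul_smul]
    module
  let Ae : E3 ≃ₗᵢ[ℝ] E3 := A.toLinearIsometryEquiv rfl
  have hAe : ∀ p : E3, Ae p = A p := fun p => rfl
  refine ⟨((barlowPeriodicConfiguration s ha0 hh0 two_ne_zero hs2).translate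
    (z 0 • layerNormal 1)).isometryImage Ae, ?_⟩
  ext q
  rw [PeriodicConfiguration.mem_points_isometryImage, PeriodicConfiguration.mem_points_translate,
    barlowPeriodicConfiguration_points, mem_barlowStacking_iff]
  simp only [Set.mem_setOf_eq]
  constructor
  · rintro ⟨k, i, j, hk⟩
    refine ⟨k, i, j, ?_⟩
    rw [sub_eq_iff_eq_add] at hk
    have : q = Ae (Ae.symm q) := (Ae.apply_symm_apply q).symm
    rw [this, hk, hAe, key]
  · rintro ⟨m, i, j, rfl⟩
    refine ⟨m, i, j, ?_⟩
    rw [← hAe, Ae.symm_apply_apply, sub_eq_iff_eq_add, key]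

/-! ## Composition -/

/-- **The crux from the stubs.** `PeriodicGivenLayered` (stmt-AtomisticToContinuum-11779, route
`PhononSlackCertificates`; verbatim `HullMinimality.PeriodicGivenLayered`): layered windows at every scale ⇒
periodic windows at every scale, for every sequence of Lennard-Jones ground states. [folklore] -/
theorem PeriodicGivenLayered_of :
    Summit.AtomisticToContinuum.Crystallization.Theses.PhononSlackCertificates.PeriodicGivenLayered := by
  unfold Summit.AtomisticToContinuum.Crystallization.Theses.PhononSlackCertificates.PeriodicGivenLayered
  intro x hx hlay
  obtain ⟨a, ha, ha1, hW⟩ := hlay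
  -- (1) one layered set in the hull
  obtain ⟨A, s, z, hs, hz, hH⟩ := stub_extraction x a ha ha1 hW
  -- (2) a uniformly recurrent layered set in the hull
  obtain ⟨s', z', hs', hz', hrec, hH'⟩ := stub_recurrence x a ha ha1 A s z hs hz hH
  -- (3)–(7) the recurrent set is fault-free and equally spaced
  obtain ⟨hU, hL⟩ := stub_windowBounds
  obtain ⟨hfault, hconst⟩ := stub_closing x hx a ha ha1 A s' z' hs' hz' hrec hH' hU hL stub_registry
    stub_convexity stub_layerCake
  -- (8) read off the periodic configuration; being in the hull is the conclusion
  obtain ⟨P, hP⟩ := pgl_readoff a ha A s' z' hz' hfault hconst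
  refine ⟨P, ?_⟩
  rw [hP]
  exact hH'

/-- **The crux, as the decl of route `HullMinimality`** (the shared item stmt-AtomisticToContinuum-11779 was
filed there; the two route decls are the same statement verbatim). [folklore] -/
theorem PeriodicGivenLayered_proof :
    Summit.AtomisticToContinuum.Crystallization.Theses.HullMinimality.PeriodicGivenLayered := by
  have h := PeriodicGivenLayered_of
  unfold Summit.AtomisticToContinuum.Crystallization.Theses.PhononSlackCertificates.PeriodicGivenLayered at h
  exact h

end Summit.AtomisticToContinuum.Crystallization.Theorems.LayeredHull

end
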